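import Summits.QuantumFields.BalabanUV.T4Continuum.Support.NE9CouplingHolomorphyLipschitz
import Summits.QuantumFields.BalabanUV.T4Continuum.Support.NE9KernelSpeciesWitness

/-!
# NE9CouplingHolomorphyWitness — the HOLOMORPHY-IN-THE-LAST-COUPLING binders of `NE9CouplingHolomorphyLipschitz` are INHABITED
# by the crew's toy data on the printed-shape window `Window γ`, and the two producers FIRE there (cell `pub-balaban`, T4-DAG §2
# node U3 ∕ §6 NE9; NE9 formalisation swarm, unit `b2b-balaban-t4-ne9-formalise-leaf-03` gen 5; own-initiative lineage item
# «A3-HOL» part 3∕3 = its honest-toy witness, CLAIMS.log l.12175; labelled TOY throughout — nothing here models Bałaban's objects)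

HONEST FRAMING (T4-DAG PAGE 1).  Rung (B)+1 of the FINITE-VOLUME T⁴ programme — NOT infinite volume, NOT a mass gap, NOT the
Clay problem.  NE9 (`T4OutputRate.NE9` ∧ `FadingMemory`) is a cell NEW ESTIMATE, NOT PRINTED, NOT discharged here; spine 0∕9;
0∕18 skeleton leaves instantiated on Bałaban's objects (O-NE9-1).  HONEST DEPENDENCY (cell line, verbatim): continuum YM on T⁴
⇐ BetaPertH ∧ nine spine estimates (0/9 proved); BetaPertH ⇐ (D1) ∧ (D4) ∧ CAP+tail; G-an2-4 gates asym, D1 and NE2/3/4.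
No `def`, no Prop-valued definition; `FlowStep.BetaPertH`, (B), (B^μ) do not occur; nothing of [I]–[II] is asserted.

WHY.  Part 1 replaced leaf A3's two coupling-Lipschitz binders by three binders each on a coupling-complexified object — (res)
restriction on the window, (hol) holomorphy on the ϱ-discs about the window's k-th couplings, (size)∕(K-on-the-disc) the SAME size
bound there.  A binder set nobody inhabits could be vacuous; the crew's standing toys settle it: leaf-09-g5's ray toy `wRem γ`
(REM-WITNESS p213736: direction `tClamp(1∕8) t · clamp_γ(s_k)`) and leaf-09-g6's kernel toy `wKer γ` (KER-WITNESS p215103: summand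
`F(0)·clamp_γ(s_k)·|p − q|·e^{−(dX p + dX q)}`) read the k-th coupling through the CLAMP `clamp_γ`, which on the printed-shape
window `T4OutputRate.Window γ` (`0 < g_i ≤ γ`) IS the identity (`gClamp_of_window`) — so the complexifications `ζ ↦ tClamp(1∕8) t · ζ`
and `ζ ↦ F(0)·ζ·(weight)` are ENTIRE in ζ, restrict correctly on every `W ⊆ Window γ`, and obey the size bounds on the discs
`|ζ − g k| < ϱ` as soon as `γ + ϱ` stays inside the toy's unit normalisations (`γ + ϱ ≤ 2` for the direction's `(1∕8)|ζ| ≤ ¼ =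
c_dir·ℓ·R`, `γ + ϱ ≤ 1` for the summand's `|ζ| ≤ 1 = cK`).
* §1 **`dirHolo_wRem`** — (res) ∧ (hol) ∧ (size) for `wRem γ` on any `W ⊆ Window γ`, `γ + ϱ ≤ 2`; **`dirLip_witness`** — part 1's
  `dirLip_of_holo` FIRES: (d2) for the toy with `clip = 2∕ϱ` (the toy's direct modulus is `½`, `dir_couplingLipschitz_wRem`; the
  general mechanism pays the factor `4∕ϱ` for not knowing the direction is linear).
* §2 **`kerHolo_wKer`** — (res) ∧ (hol) ∧ (K-on-the-disc) for `wKer γ` on any `W ⊆ Window γ`, `γ + ϱ ≤ 1`, letters `cK = 1`,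
  `gain ≡ 1⁵`, `δ₀ = 1` of `admissible_wKer`; **`kerLip_witness`** — `kerLip_of_holo` FIRES: (K-Lip) for the toy with `λ = 2∕ϱ`
  (direct: `λ = 1`, `kerL_wKer`).
DISGUISE TEST: toys; last coupling only; not NE9.  Value = non-vacuity of part 1's binder sets on data with nonempty index families
and genuinely coupling-dependent directions ∕ summands, on the window shape the END uses — NOT summit progress.

References (TYPES only, for the letters the toys imitate): [Balaban1988RG2Cluster] T. Bałaban, CMP **116** (1988) 1–22, (1.23)–(1.25)
p. 7; [Balaban1987RG1] T. Bałaban, CMP **109** (1987) 249–301, (2.12) p. 268, (4.22) p. 286.  Summits-side NEW work (LEAN PLACEMENT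
RULE); imports part 1 and KER-WITNESS `NE9KernelSpeciesWitness` (p215103; hence REM-WITNESS `NE9RemainderSpeciesWitness` p213736) BY
NAME; modifies nothing.
-/

noncomputable section

namespace Summit.QuantumFields.BalabanUV.T4Continuum.NE9CouplingHolomorphyWitness

open scoped BigOperators
open Metric Set Complex
open Literature.MathematicalPhysics.QuantumFieldTheory.Balaban1983to89
open Literature.MathematicalPhysics.QuantumFieldTheory.Balaban1983to89.T4OutputRate
open Summit.QuantumFields.BalabanUV.T4Continuum.NE9Lemma1RemainderSpecies
open Summit.QuantumFields.BalabanUV.T4Continuum.NE9Lemma1KernelSpecies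
open Summit.QuantumFields.BalabanUV.T4Continuum.NE9ComplexEncoding (doubleCarriers)
open Literature.MathematicalPhysics.QuantumFieldTheory.Balaban1983to89.T4HistoryLipschitzRecursion (toyCarriers)
open Summit.QuantumFields.BalabanUV.T4Continuum.NE9RemainderSpeciesWitness
  (tClamp gClamp norm_tClamp_le gClamp_of_window wRem)
open Summit.QuantumFields.BalabanUV.T4Continuum.NE9KernelSpeciesWitness (wKer weight_nonneg)
open Summit.QuantumFields.BalabanUV.T4Continuum.NE9CouplingHolomorphyLipschitz (dirLip_of_holo kerLip_of_holo)

/-- On a disc of radius `ϱ` about a window coupling `0 < g k ≤ γ` every point has modulus `< γ + ϱ`. [folklore] -/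
theorem norm_lt_of_mem_ball_window {γ ϱ c : ℝ} (hc : 0 < c ∧ c ≤ γ) {ζ : ℂ} (hζ : ζ ∈ ball (c : ℂ) ϱ) : ‖ζ‖ < γ + ϱ := by
  have h1 : ‖ζ - (c : ℂ)‖ < ϱ := by rwa [mem_ball, dist_eq_norm] at hζ
  calc ‖ζ‖ = ‖(ζ - c) + c‖ := by rw [sub_add_cancel]
    _ ≤ ‖ζ - (c : ℂ)‖ + ‖(c : ℂ)‖ := norm_add_le _ _
    _ < ϱ + γ := by
        rw [norm_real, Real.norm_eq_abs, abs_of_pos hc.1]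
        exact add_lt_add_of_lt_of_le h1 hc.2
    _ = γ + ϱ := add_comm _ _

/-! ## §1 The ray toy: the direction's holomorphy binders and (d2) by the general mechanism -/

/-- **(res) ∧ (hol) ∧ (size) FOR THE RAY TOY `wRem γ`** on any window `W ⊆ Window γ` with `γ + ϱ ≤ 2`, for the complexified
direction `ζ ↦ tClamp(1∕8) t · ζ`: on the window the clamp is the identity; the map is entire in ζ; on the disc `(1∕8)·|ζ| <
(1∕8)(γ + ϱ) ≤ ¼ = c_dir·ℓ·R` (`c_dir = ¼`, `ℓ ≡ 1`, `R ≡ 1` of `admissible_wRem`).  Labelled toy. [folklore] -/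
theorem dirHolo_wRem {γ ϱ : ℝ} (hγϱ : γ + ϱ ≤ 2) {W : Set (ℕ → ℝ)} (hW : W ⊆ Window γ) :
    (∀ g ∈ W, ∀ (k : ℕ) (y : Unit), ∀ a ∈ (wRem γ).S0 k y, ∀ b ∈ (wRem γ).SY k y a, ∀ (j : ℕ), ∀ x ∈ (wRem γ).src k y a j,
      ∀ t ∈ sphere (0:ℂ) ((wRem γ).r k), ∀ (s' : Unit → ℝ) (σ' : Unit → ℂ),
        OnContour (wRem γ).κ₁ ((wRem γ).cubes k y a b) s' σ' →
          (wRem γ).dir k g y a b x t s' σ' =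
            (fun (_ : ℕ) (ζ : ℂ) (_ _ _ : Unit) (_ : (doubleCarriers toyCarriers).Dom) (t : ℂ) (_ : Unit → ℝ)
              (_ : Unit → ℂ) => tClamp (1 / 8) t * ζ) k (g k : ℂ) y a b x t s' σ') ∧
    (∀ g ∈ W, ∀ (k : ℕ) (y : Unit), ∀ a ∈ (wRem γ).S0 k y, ∀ b ∈ (wRem γ).SY k y a, ∀ (j : ℕ), ∀ x ∈ (wRem γ).src k y a j,
      ∀ t ∈ sphere (0:ℂ) ((wRem γ).r k), ∀ (s' : Unit → ℝ) (σ' : Unit → ℂ),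
        OnContour (wRem γ).κ₁ ((wRem γ).cubes k y a b) s' σ' →
          DifferentiableOn ℂ (fun ζ : ℂ =>
            (fun (_ : ℕ) (ζ : ℂ) (_ _ _ : Unit) (_ : (doubleCarriers toyCarriers).Dom) (t : ℂ) (_ : Unit → ℝ)
              (_ : Unit → ℂ) => tClamp (1 / 8) t * ζ) k ζ y a b x t s' σ') (ball (g k : ℂ) ϱ)) ∧
    (∀ g ∈ W, ∀ (k : ℕ) (y : Unit), ∀ a ∈ (wRem γ).S0 k y, ∀ b ∈ (wRem γ).SY k y a, ∀ (j : ℕ), ∀ x ∈ (wRem γ).src k y a j,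
      ∀ t ∈ sphere (0:ℂ) ((wRem γ).r k), ∀ (s' : Unit → ℝ) (σ' : Unit → ℂ),
        OnContour (wRem γ).κ₁ ((wRem γ).cubes k y a b) s' σ' →
          ∀ ζ ∈ ball (g k : ℂ) ϱ,
            ‖(fun (_ : ℕ) (ζ : ℂ) (_ _ _ : Unit) (_ : (doubleCarriers toyCarriers).Dom) (t : ℂ) (_ : Unit → ℝ)
              (_ : Unit → ℂ) => tClamp (1 / 8) t * ζ) k ζ y a b x t s' σ'‖ ≤
                1 / 4 * (fun _ _ : ℕ => (1:ℝ)) k j * (wRem γ).R x.1) := by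
  refine ⟨?_, ?_, ?_⟩
  · intro g hg k y a _ b _ j x _ t _ s' σ' _
    have hgk := hW hg k
    show tClamp (1 / 8) t * (gClamp γ (g k) : ℂ) = tClamp (1 / 8) t * (g k : ℂ)
    rw [gClamp_of_window hgk.1 hgk.2]
  · intro g _ k y a _ b _ j x _ t _ s' σ' _
    exact ((differentiable_id : Differentiable ℂ fun ζ : ℂ => ζ).const_mul (tClamp (1 / 8) t)).differentiableOn
  · intro g hg k y a _ b _ j x _ t _ s' σ' _ ζ hζ
    have hgk := hW hg k
    have hζ' := norm_lt_of_mem_ball_window hgk hζ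
    show ‖tClamp (1 / 8) t * ζ‖ ≤ 1 / 4 * 1 * 1
    rw [norm_mul]
    have h1 := norm_tClamp_le (by norm_num : (0:ℝ) < 1 / 8) t
    calc ‖tClamp (1 / 8) t‖ * ‖ζ‖ ≤ (1 / 8) * (γ + ϱ) := mul_le_mul h1 hζ'.le (norm_nonneg _) (by norm_num)
      _ ≤ 1 / 4 * 1 * 1 := by linarith

/-- **`dirLip_of_holo` FIRES ON THE RAY TOY**: on `W ⊆ Window γ`, `γ + ϱ ≤ 2`, `0 < ϱ`, the toy directions obey (d2) with the
general mechanism's constant `clip = 2∕ϱ` (letters `c_dir = ¼`, `ℓ ≡ 1`).  Labelled toy. [folklore] -/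
theorem dirLip_witness {γ ϱ : ℝ} (hϱ : 0 < ϱ) (hγϱ : γ + ϱ ≤ 2) {W : Set (ℕ → ℝ)} (hW : W ⊆ Window γ) :
    ∀ g ∈ W, ∀ g' ∈ W, ∀ (k : ℕ) (y : Unit), ∀ a ∈ (wRem γ).S0 k y, ∀ b ∈ (wRem γ).SY k y a, ∀ (j : ℕ),
      ∀ x ∈ (wRem γ).src k y a j, ∀ t ∈ sphere (0:ℂ) ((wRem γ).r k), ∀ (s' : Unit → ℝ) (σ' : Unit → ℂ),
        OnContour (wRem γ).κ₁ ((wRem γ).cubes k y a b) s' σ' →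
          ‖(wRem γ).dir k g y a b x t s' σ' - (wRem γ).dir k g' y a b x t s' σ'‖ ≤
            2 / ϱ * (1 / 4 * (fun _ _ : ℕ => (1:ℝ)) k j * (wRem γ).R x.1) * |g k - g' k| :=
  dirLip_of_holo (wRem γ) hϱ _ (dirHolo_wRem hγϱ hW).1 (dirHolo_wRem hγϱ hW).2.1 (dirHolo_wRem hγϱ hW).2.2

/-! ## §2 The kernel toy: the summand's holomorphy binders and (K-Lip) by the general mechanism -/

/-- **(res) ∧ (hol) ∧ (K-on-the-disc) FOR THE KERNEL TOY `wKer γ`** on any window `W ⊆ Window γ` with `γ + ϱ ≤ 1`, for the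
complexified summand `ζ ↦ F(0)·ζ·(|p − q|·e^{−(dX p + dX q)})`: on the window the clamp is the identity; the map is entire in ζ;
on the disc `|ζ| < γ + ϱ ≤ 1` and `‖F 0‖ ≤ M`, so the (K)-shape bound with `cK = 1`, `gain ≡ 1⁵`, `δ₀ = 1` (the letters of
`admissible_wKer`) holds there.  Labelled toy. [folklore] -/
theorem kerHolo_wKer {γ ϱ : ℝ} (hγϱ : γ + ϱ ≤ 1) {W : Set (ℕ → ℝ)} (hW : W ⊆ Window γ) :
    (∀ g ∈ W, ∀ (k : ℕ) (y : Unit), ∀ a ∈ (wKer γ).S0 k y, ∀ b ∈ (wKer γ).SY k y a, ∀ (j : ℕ), ∀ x ∈ (wKer γ).src k y a j,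
      ∀ t ∈ sphere (0:ℂ) ((wKer γ).r k), ∀ (s' : Unit → ℝ) (σ' : Unit → ℂ),
        OnContour (wKer γ).κ₁ ((wKer γ).cubes k y a b) s' σ' →
          ∀ p ∈ (wKer γ).pts k y a, ∀ q ∈ (wKer γ).pts k y a, ∀ F : ℂ → ℂ, DifferentiableOn ℂ F (ball 0 ((wKer γ).R x.1)) →
            (wKer γ).ker k g y a b x t s' σ' p q F =
              (fun (_ : ℕ) (ζ : ℂ) (_ _ _ : Unit) (_ : (doubleCarriers toyCarriers).Dom) (_ : ℂ) (_ : Unit → ℝ) (_ : Unit → ℂ)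
                (p q : Fin 4 → ℤ) (F : ℂ → ℂ) => F 0 * (ζ * ((dist p q *
                  Real.exp (-(infDist p ({0} : Set (Fin 4 → ℤ)) + infDist q ({0} : Set (Fin 4 → ℤ)))) : ℝ) : ℂ)))
                k (g k : ℂ) y a b x t s' σ' p q F) ∧
    (∀ g ∈ W, ∀ (k : ℕ) (y : Unit), ∀ a ∈ (wKer γ).S0 k y, ∀ b ∈ (wKer γ).SY k y a, ∀ (j : ℕ), ∀ x ∈ (wKer γ).src k y a j,
      ∀ t ∈ sphere (0:ℂ) ((wKer γ).r k), ∀ (s' : Unit → ℝ) (σ' : Unit → ℂ),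
        OnContour (wKer γ).κ₁ ((wKer γ).cubes k y a b) s' σ' →
          ∀ p ∈ (wKer γ).pts k y a, ∀ q ∈ (wKer γ).pts k y a, ∀ F : ℂ → ℂ, DifferentiableOn ℂ F (ball 0 ((wKer γ).R x.1)) →
            DifferentiableOn ℂ (fun ζ : ℂ =>
              (fun (_ : ℕ) (ζ : ℂ) (_ _ _ : Unit) (_ : (doubleCarriers toyCarriers).Dom) (_ : ℂ) (_ : Unit → ℝ) (_ : Unit → ℂ)
                (p q : Fin 4 → ℤ) (F : ℂ → ℂ) => F 0 * (ζ * ((dist p q *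
                  Real.exp (-(infDist p ({0} : Set (Fin 4 → ℤ)) + infDist q ({0} : Set (Fin 4 → ℤ)))) : ℝ) : ℂ)))
                k ζ y a b x t s' σ' p q F) (ball (g k : ℂ) ϱ)) ∧
    (∀ g ∈ W, ∀ (k : ℕ) (y : Unit), ∀ a ∈ (wKer γ).S0 k y, ∀ b ∈ (wKer γ).SY k y a, ∀ (j : ℕ), ∀ x ∈ (wKer γ).src k y a j,
      ∀ t ∈ sphere (0:ℂ) ((wKer γ).r k), ∀ (s' : Unit → ℝ) (σ' : Unit → ℂ),
        OnContour (wKer γ).κ₁ ((wKer γ).cubes k y a b) s' σ' →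
          ∀ p ∈ (wKer γ).pts k y a, ∀ q ∈ (wKer γ).pts k y a, ∀ (F : ℂ → ℂ) (M : ℝ),
            DifferentiableOn ℂ F (ball 0 ((wKer γ).R x.1)) → (∀ z ∈ ball (0:ℂ) ((wKer γ).R x.1), ‖F z‖ ≤ M) →
              ∀ ζ ∈ ball (g k : ℂ) ϱ,
                ‖(fun (_ : ℕ) (ζ : ℂ) (_ _ _ : Unit) (_ : (doubleCarriers toyCarriers).Dom) (_ : ℂ) (_ : Unit → ℝ) (_ : Unit → ℂ)
                  (p q : Fin 4 → ℤ) (F : ℂ → ℂ) => F 0 * (ζ * ((dist p q *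
                    Real.exp (-(infDist p ({0} : Set (Fin 4 → ℤ)) + infDist q ({0} : Set (Fin 4 → ℤ)))) : ℝ) : ℂ)))
                  k ζ y a b x t s' σ' p q F‖ ≤
                  1 * M * (fun _ _ : ℕ => (1:ℝ) ^ 5) k j * (wKer γ).ρd p q ^ (wKer γ).m *
                    Real.exp (-(1 * ((wKer γ).dX x.1 p + (wKer γ).dX x.1 q)))) := by
  refine ⟨?_, ?_, ?_⟩
  · intro g hg k y a _ b _ j x _ t _ s' σ' _ p _ q _ F _
    have hgk := hW hg k
    show F 0 * ((gClamp γ (g k) * (dist p q * Real.exp (-(infDist p ({0} : Set (Fin 4 → ℤ)) +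
        infDist q ({0} : Set (Fin 4 → ℤ))))) : ℝ) : ℂ) = F 0 * ((g k : ℂ) * ((dist p q *
          Real.exp (-(infDist p ({0} : Set (Fin 4 → ℤ)) + infDist q ({0} : Set (Fin 4 → ℤ)))) : ℝ) : ℂ))
    rw [gClamp_of_window hgk.1 hgk.2]; push_cast; ring
  · intro g _ k y a _ b _ j x _ t _ s' σ' _ p _ q _ F _
    exact (((differentiable_id : Differentiable ℂ fun ζ : ℂ => ζ).mul_const _).const_mul (F 0)).differentiableOn
  · intro g hg k y a _ b _ j x _ t _ s' σ' _ p _ q _ F M _ hM ζ hζ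
    have hgk := hW hg k
    have hζ1 : ‖ζ‖ ≤ 1 := ((norm_lt_of_mem_ball_window hgk hζ).le).trans hγϱ
    have hF0 : ‖F 0‖ ≤ M := hM 0 (by show (0 : ℂ) ∈ ball (0:ℂ) 1; simp)
    have hM0 : 0 ≤ M := (norm_nonneg _).trans hF0
    have hD := weight_nonneg p q
    set D : ℝ := dist p q * Real.exp (-(infDist p ({0} : Set (Fin 4 → ℤ)) + infDist q ({0} : Set (Fin 4 → ℤ)))) with hDdef
    show ‖F 0 * (ζ * (D : ℂ))‖ ≤ 1 * M * (1 : ℝ) ^ 5 * dist p q ^ 1 *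
      Real.exp (-(1 * (infDist p ({0} : Set (Fin 4 → ℤ)) + infDist q ({0} : Set (Fin 4 → ℤ)))))
    rw [norm_mul, norm_mul, norm_real, Real.norm_eq_abs, abs_of_nonneg hD, one_mul, one_pow, mul_one, pow_one, one_mul]
    calc ‖F 0‖ * (‖ζ‖ * D) ≤ M * (1 * D) :=
          mul_le_mul hF0 (mul_le_mul_of_nonneg_right hζ1 hD) (mul_nonneg (norm_nonneg _) hD) hM0
      _ = dist p q * Real.exp (-(infDist p ({0} : Set (Fin 4 → ℤ)) + infDist q ({0} : Set (Fin 4 → ℤ)))) * M := by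
          rw [hDdef]; ring
      _ = M * dist p q * Real.exp (-(infDist p ({0} : Set (Fin 4 → ℤ)) + infDist q ({0} : Set (Fin 4 → ℤ)))) := by ring

/-- **`kerLip_of_holo` FIRES ON THE KERNEL TOY**: on `W ⊆ Window γ`, `γ + ϱ ≤ 1`, `0 < ϱ`, the toy summand obeys (K-Lip) with the
general mechanism's relative modulus `λ = 2∕ϱ` (letters `cK = 1`, `gain ≡ 1⁵`, `δ₀ = 1`).  Labelled toy. [folklore] -/
theorem kerLip_witness {γ ϱ : ℝ} (hϱ : 0 < ϱ) (hγϱ : γ + ϱ ≤ 1) {W : Set (ℕ → ℝ)} (hW : W ⊆ Window γ) :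
    ∀ g ∈ W, ∀ g' ∈ W, ∀ (k : ℕ) (y : Unit), ∀ a ∈ (wKer γ).S0 k y, ∀ b ∈ (wKer γ).SY k y a, ∀ (j : ℕ),
      ∀ x ∈ (wKer γ).src k y a j, ∀ t ∈ sphere (0:ℂ) ((wKer γ).r k), ∀ (s' : Unit → ℝ) (σ' : Unit → ℂ),
        OnContour (wKer γ).κ₁ ((wKer γ).cubes k y a b) s' σ' → ∀ p ∈ (wKer γ).pts k y a, ∀ q ∈ (wKer γ).pts k y a,
          ∀ (F : ℂ → ℂ) (M : ℝ), DifferentiableOn ℂ F (ball 0 ((wKer γ).R x.1)) →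
            (∀ z ∈ ball (0:ℂ) ((wKer γ).R x.1), ‖F z‖ ≤ M) →
              ‖(wKer γ).ker k g y a b x t s' σ' p q F - (wKer γ).ker k g' y a b x t s' σ' p q F‖ ≤
                1 * (2 / ϱ) * M * (fun _ _ : ℕ => (1:ℝ) ^ 5) k j * (wKer γ).ρd p q ^ (wKer γ).m *
                  Real.exp (-(1 * ((wKer γ).dX x.1 p + (wKer γ).dX x.1 q))) * |g k - g' k| :=
  kerLip_of_holo (wKer γ) hϱ _ (kerHolo_wKer hγϱ hW).1 (kerHolo_wKer hγϱ hW).2.1 (kerHolo_wKer hγϱ hW).2.2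

/-- The hypotheses are jointly satisfiable with a nonempty window: `γ = ½`, `ϱ = ½`, `W = Window ½ ∋ (fun _ => ½)`. [folklore] -/
example : (fun _ : ℕ => (1 / 2 : ℝ)) ∈ Window (1 / 2) ∧ (1 / 2 : ℝ) + 1 / 2 ≤ 1 ∧ (1 / 2 : ℝ) + 1 / 2 ≤ 2 ∧ (0 : ℝ) < 1 / 2 :=
  ⟨fun _ => ⟨by norm_num, le_rfl⟩, by norm_num, by norm_num, by norm_num⟩

end Summit.QuantumFields.BalabanUV.T4Continuum.NE9CouplingHolomorphyWitness

end
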